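import Literature.NumberTheory.Automorphic.EichlerSelbergBrandtResummation
import HarnessLib

/-!
# k3 · generation 7 sketch for `stub_takahashi` (crux `stmt-ABC-11338`, `DefiniteRTControlPrime`)

FAMILY 3 (probe the extremes), two techniques, applied to the ONE arithmetic node of the k3 depth path
that gen 6 left as an `M`-sized sorry — H6.A8 `chain_identity_levelPow_unram/_ram` (the chain identity at
level `q^e`, feeding `LocalChainIdentityPow` = L3 ⇒ H0 Pizer (2.8) ⇒ H1 rank one ⇒ stub):

* T1 **perturbation from the proved neighbour** `e = 1` (tree `Brandt.chain_identity_level`): both sides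
  obey the SAME diagonal recursion `S(e+1, a+1) = q·S(e, a) + W_{a+1}·N(a+1, e+1)` — the CO side termwise
  (`chainMu_succ_succ`), the Brandt side by a one-index-shift telescope with exact defect `X(2-X)`
  (`lhs_step_defect`), which vanishes precisely on the admissible tops `X ∈ {0,2}`; bases `a = 0` (rfl-level)
  and `e = 1` (= `chain_identity_level`).  H6.A8 drops from M to four S⁻ lemmas + a 10-line induction
  (`lhs_eq_rhs_unram/_ram`, kernel-checked below modulo the four sorries).
* T2 **degenerate parameter / extremal configuration**: (i) `q = 0` REFUTES H6.A8u exactly as gen 6 typed it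
  (no `q ≠ 0`; kernel example `gen6_H6A8u_false_at_q_zero`) — the repaired statements carry `hq : q ≠ 0`;
  (ii) the crux-relevant ceiling is `q = 2, e ≤ 8` (Frey: `N ∣ 2^8·rad`, tree `conductorNorm_freyCurve_dvd`):
  kernel examples certify the identity at `(q, e) = (2, 8)` for all three 2-adic top types.

Definitions `chainN / chainM / chainMu` are copied VERBATIM from gen 6 (`StubIdeas3g6Sketch.lean` ll. 209–224,
certified there against brute force on 1350 chain members); `chainW`, `chain_identity_level` are the tree's.
Numerics behind the statements: `scratch/chain_rec.py` (768 recursion cases), `scratch/chain_defect.py`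
(1536 general-`X` defect cases), `scratch/chain_id.py` (1080 identity cases) — 0 failures.
-/

noncomputable section

open Finset
open scoped BigOperators

set_option linter.unusedVariables false
set_option linter.dupNamespace false

namespace Summit.ABC.ABC.Cruxes.DefiniteRTControlPrime.StubIdeas3g7

open Literature.NumberTheory.Automorphic Literature.NumberTheory.Automorphic.Brandt

/-! ## Definitions (verbatim from gen 6) -/

/-- Root counts `N(k, s)` of the order at depth `k` below the top of the chain, from the top counts `ν`. -/
def chainN (q : ℚ) (ν : ℕ → ℚ) : ℕ → ℕ → ℚ
  | 0, s => ν s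
  | _ + 1, 0 => 1
  | _ + 1, 1 => 1
  | k + 1, s + 2 => q * chainN q ν k s

/-- Brandt local factor of the depth-`k` order: `N(k,e) + [k ≠ 0 ∨ ram] N(k,e+1)/q`. -/
def chainM (q : ℚ) (ν : ℕ → ℚ) (ram : Bool) (e k : ℕ) : ℚ :=
  chainN q ν k e + (if k = 0 ∧ ram = false then 0 else chainN q ν k (e + 1) / q)

/-- CO density of the order at depth `k`, distance `j` from the bottom: `ψ(q^e)` if `j ≥ e`, else `q^j N(k, e-j)`. -/
def chainMu (q : ℚ) (ν : ℕ → ℚ) (e j k : ℕ) : ℚ :=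
  if e ≤ j then (q + 1) * q ^ (e - 1) else q ^ j * chainN q ν k (e - j)

/-- Brandt side of H6.A8 as a function of `(e, a)`. -/
def lhs (q Y : ℚ) (ν : ℕ → ℚ) (ram : Bool) (e a : ℕ) : ℚ :=
  ∑ k ∈ range (a + 1), chainW q Y k * chainM q ν ram e k

/-- CO side of H6.A8 as a function of `(e, a)`. -/
def rhs (q Y : ℚ) (ν : ℕ → ℚ) (e a : ℕ) : ℚ :=
  ∑ k ∈ range (a + 1), chainW q Y k * chainMu q ν e (a - k) k

/-! ## T2(i) — degenerate parameter: gen 6's H6.A8u as typed is false at `q = 0` -/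

/-- FAMILY 3, minimal-counterexample shape: `q = 0, X = 2, e = 2, a = 2` (Lean conventions `x / 0 = 0`,
`0 ^ 0 = 1`): Brandt side `= 2`, CO side `= 0`.  Hence every level-`q^e` chain lemma must carry `q ≠ 0`
(free downstream: `q` is a prime cast to `ℚ`).  PROVED (kernel). -/
theorem gen6_H6A8u_false_at_q_zero :
    ¬ (∀ (q X : ℚ), (X = 0 ∨ X = 2) → ∀ ν : ℕ → ℚ, ν 0 = 1 → (∀ s, 1 ≤ s → ν s = X) →
        ∀ (e : ℕ), 1 ≤ e → ∀ a : ℕ,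
          ∑ k ∈ range (a + 1), chainW q (q + 1 - X) k * chainM q ν false e k =
            ∑ k ∈ range (a + 1), chainW q (q + 1 - X) k * chainMu q ν e (a - k) k) := by
  intro h
  have h1 := h 0 2 (Or.inr rfl) (fun s => if s = 0 then 1 else 2) (by simp)
    (fun s hs => by simp; omega) 2 (by norm_num) 2
  simp [Finset.sum_range_succ, chainW, chainM, chainMu, chainN] at h1

/-! ## T1 — the diagonal recursion (helper lemmas H7.1–H7.7) -/

/-- H7.1 (XS) chain shift: `N(k+1, s+2) = q·N(k, s)`.  PROVED (rfl). -/
theorem chainN_succ_add_two (q : ℚ) (ν : ℕ → ℚ) (k s : ℕ) :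
    chainN q ν (k + 1) (s + 2) = q * chainN q ν k s := rfl

/-- H7.2 (S⁻) CO side, termwise: `μ_{e+1, j+1}(k) = q·μ_{e, j}(k)` for `e ≥ 1` (both branches of `chainMu`;
`ψ(q^{e+1}) = q ψ(q^e)` and `q^{j+1} N(k, e-j) = q·q^j N(k, e-j)`).  No hypothesis on `q`. -/
theorem chainMu_succ_succ (q : ℚ) (ν : ℕ → ℚ) {e : ℕ} (he : 1 ≤ e) (j k : ℕ) :
    chainMu q ν (e + 1) (j + 1) k = q * chainMu q ν e j k := by
  sorry

/-- H7.3 (S⁻) CO side recursion: peel the last summand (`μ_{e+1,0}(a+1) = N(a+1, e+1)`) and apply H7.2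
termwise (`a + 1 - k = (a - k) + 1` for `k ≤ a`).  Holds for every `q, Y, ν`. -/
theorem rhs_step (q Y : ℚ) (ν : ℕ → ℚ) {e : ℕ} (he : 1 ≤ e) (a : ℕ) :
    rhs q Y ν (e + 1) (a + 1) = q * rhs q Y ν e a + chainW q Y (a + 1) * chainN q ν (a + 1) (e + 1) := by
  sorry

/-- H7.4 (S) Brandt side recursion WITH EXACT DEFECT, unramified top `ν ≡ X (s ≥ 1)`, any `X`:
`L(e+1,a+1) = q L(e,a) + W_{a+1} N(a+1,e+1) + X(2-X)`.  Proof (one index shift, no closed form):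
for `1 ≤ k ≤ a`, `M_{e+1}(k) - q M_e(k) = N(k,e+2)/q - q N(k,e) = N(k-1,e) - q N(k,e)` (H7.1, `q ≠ 0`);
`k = 0`: `ν(e+1) - q ν(e) = (1-q)X`; last summand contributes `W_{a+1} N(a,e)`; with `W_k = Y q^{k-1}` the two
sums `Σ_{k=1}^{a+1} W_k N(k-1,e)` and `q Σ_{k=1}^{a} W_k N(k,e)` cancel up to `Y·N(0,e) = Y X`; total
`(1-q)X + (q+1-X)X = X(2-X)`.  Certified on 1536 cases incl. `X ∉ {0,2}` (`scratch/chain_defect.py`). -/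
theorem lhs_step_defect (q X : ℚ) (hq : q ≠ 0) (ν : ℕ → ℚ) (hν : ∀ s, 1 ≤ s → ν s = X) {e : ℕ}
    (he : 1 ≤ e) (a : ℕ) :
    lhs q (q + 1 - X) ν false (e + 1) (a + 1) =
      q * lhs q (q + 1 - X) ν false e a + chainW q (q + 1 - X) (a + 1) * chainN q ν (a + 1) (e + 1)
        + X * (2 - X) := by
  sorry

/-- H7.5 (S) Brandt side recursion, ramified top (`ν 1 = 1`, `ν s = 0` for `s ≥ 2`, `Y = q`): exact (the
`k = 0` summand carries the lift; its increment `M_{e+1}(0) - q M_e(0)` is `0` for `e ≥ 2` and `-q` for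
`e = 1`, cancelled by `Y·ν(e) = q·[e = 1]`).  Same telescope as H7.4. -/
theorem lhs_step_ram (q : ℚ) (hq : q ≠ 0) (ν : ℕ → ℚ) (hν1 : ν 1 = 1) (hν : ∀ s, 2 ≤ s → ν s = 0)
    {e : ℕ} (he : 1 ≤ e) (a : ℕ) :
    lhs q (q + 1 - 1) ν true (e + 1) (a + 1) =
      q * lhs q (q + 1 - 1) ν true e a + chainW q (q + 1 - 1) (a + 1) * chainN q ν (a + 1) (e + 1) := by
  sorry

/-- H7.6u (XS) base `a = 0`, unramified: both sides are `ν e` (`e ≥ 1` kills the `ψ` branch).  PROVED. -/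
theorem lhs_eq_rhs_zero_unram (q Y : ℚ) (ν : ℕ → ℚ) {e : ℕ} (he : 1 ≤ e) :
    lhs q Y ν false e 0 = rhs q Y ν e 0 := by
  have h : ¬ (e ≤ 0) := by omega
  simp [lhs, rhs, chainW, chainM, chainMu, chainN, h]

/-- H7.6r (XS) base `a = 0`, ramified: `ν e + ν(e+1)/q = ν e` since `ν(e+1) = 0`.  PROVED. -/
theorem lhs_eq_rhs_zero_ram (q Y : ℚ) (ν : ℕ → ℚ) (hν : ∀ s, 2 ≤ s → ν s = 0) {e : ℕ} (he : 1 ≤ e) :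
    lhs q Y ν true e 0 = rhs q Y ν e 0 := by
  have h : ¬ (e ≤ 0) := by omega
  simp [lhs, rhs, chainW, chainM, chainMu, chainN, h, hν (e + 1) (by omega)]

/-- H7.7u (S⁻) base `e = 1`, unramified = the tree's `chain_identity_level q X a` read right-to-left, after the
pointwise identifications `M_1(k) = if 0 < k then 2 else X` and `μ_{1,a-k}(k) = if k < a then q+1 else if
1 ≤ a then 1 else X` (`Finset.sum_congr`). -/
theorem lhs_eq_rhs_one_unram (q X : ℚ) (ν : ℕ → ℚ) (hν0 : ν 0 = 1) (hν1 : ν 1 = X) (a : ℕ) :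
    lhs q (q + 1 - X) ν false 1 a = rhs q (q + 1 - X) ν 1 a := by
  sorry

/-- H7.7r (S⁻) base `e = 1`, ramified = `chain_identity_level q 1 a` (`M_1(0) = ν 1 + ν 2/q = 1 = X`). -/
theorem lhs_eq_rhs_one_ram (q : ℚ) (ν : ℕ → ℚ) (hν0 : ν 0 = 1) (hν1 : ν 1 = 1) (hν2 : ν 2 = 0) (a : ℕ) :
    lhs q (q + 1 - 1) ν true 1 a = rhs q (q + 1 - 1) ν 1 a := by
  sorry

/-! ## Assembly of H6.A8 from H7.2–H7.7 (kernel-checked induction on `a`, `e` generalised) -/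

/-- **H6.A8u repaired** (`hq` added): the chain identity at level `q^e`, unramified top.  PROVED from
H7.3, H7.4, H7.6u, H7.7u: induction on `a`; at `a+1`, `e = 1` is the base, `e = e'+1 ≥ 2` is the diagonal
step from `(e', a)`, where the defect `X(2-X)` vanishes by `hX`. -/
theorem lhs_eq_rhs_unram (q X : ℚ) (hq : q ≠ 0) (hX : X = 0 ∨ X = 2) (ν : ℕ → ℚ) (hν0 : ν 0 = 1)
    (hν : ∀ s, 1 ≤ s → ν s = X) : ∀ (a : ℕ) {e : ℕ}, 1 ≤ e →
      lhs q (q + 1 - X) ν false e a = rhs q (q + 1 - X) ν e a := by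
  intro a
  induction a with
  | zero => intro e he; exact lhs_eq_rhs_zero_unram q _ ν he
  | succ a ih =>
    intro e he
    rcases Nat.lt_or_ge 1 e with h1 | h1
    · obtain ⟨e', rfl⟩ : ∃ e', e = e' + 1 := ⟨e - 1, by omega⟩
      have he' : 1 ≤ e' := by omega
      have hXX : X * (2 - X) = 0 := by rcases hX with rfl | rfl <;> norm_num
      rw [lhs_step_defect q X hq ν hν he' a, rhs_step q _ ν he' a, ih he', hXX, add_zero]
    · obtain rfl : e = 1 := le_antisymm h1 he
      exact lhs_eq_rhs_one_unram q X ν hν0 (hν 1 le_rfl) (a + 1)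

/-- **H6.A8r repaired**: the chain identity at level `q^e`, ramified top.  PROVED from H7.3, H7.5, H7.6r, H7.7r. -/
theorem lhs_eq_rhs_ram (q : ℚ) (hq : q ≠ 0) (ν : ℕ → ℚ) (hν0 : ν 0 = 1) (hν1 : ν 1 = 1)
    (hν : ∀ s, 2 ≤ s → ν s = 0) : ∀ (a : ℕ) {e : ℕ}, 1 ≤ e →
      lhs q (q + 1 - 1) ν true e a = rhs q (q + 1 - 1) ν e a := by
  intro a
  induction a with
  | zero => intro e he; exact lhs_eq_rhs_zero_ram q _ ν hν he
  | succ a ih =>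
    intro e he
    rcases Nat.lt_or_ge 1 e with h1 | h1
    · obtain ⟨e', rfl⟩ : ∃ e', e = e' + 1 := ⟨e - 1, by omega⟩
      have he' : 1 ≤ e' := by omega
      rw [lhs_step_ram q hq ν hν1 hν he' a, rhs_step q _ ν he' a, ih he']
    · obtain rfl : e = 1 := le_antisymm h1 he
      exact lhs_eq_rhs_one_ram q ν hν0 hν1 (hν 2 le_rfl) (a + 1)

/-- Gen 6's H6.A8u in its own summation shape, with `hq` added — definitionally `lhs_eq_rhs_unram`.  PROVED. -/
theorem chain_identity_levelPow_unram (q X : ℚ) (hq : q ≠ 0) (hX : X = 0 ∨ X = 2) (ν : ℕ → ℚ)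
    (hν0 : ν 0 = 1) (hν : ∀ s, 1 ≤ s → ν s = X) {e : ℕ} (he : 1 ≤ e) (a : ℕ) :
    ∑ k ∈ range (a + 1), chainW q (q + 1 - X) k * chainM q ν false e k =
      ∑ k ∈ range (a + 1), chainW q (q + 1 - X) k * chainMu q ν e (a - k) k :=
  lhs_eq_rhs_unram q X hq hX ν hν0 hν a he

/-- Gen 6's H6.A8r in its own summation shape, with `hq` added.  PROVED. -/
theorem chain_identity_levelPow_ram (q : ℚ) (hq : q ≠ 0) (ν : ℕ → ℚ) (hν0 : ν 0 = 1) (hν1 : ν 1 = 1)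
    (hν : ∀ s, 2 ≤ s → ν s = 0) {e : ℕ} (he : 1 ≤ e) (a : ℕ) :
    ∑ k ∈ range (a + 1), chainW q (q + 1 - 1) k * chainM q ν true e k =
      ∑ k ∈ range (a + 1), chainW q (q + 1 - 1) k * chainMu q ν e (a - k) k :=
  lhs_eq_rhs_ram q hq ν hν0 hν1 hν a he

/-! ## T2(ii) — the 2-adic ceiling `q = 2, e = 8` (kernel certificates, all three 2-adic top types) -/

/-- split top (`X = 2`, `Y = 1`), `e = 8`, `a = 3`.  PROVED (kernel). -/
example : lhs 2 (2 + 1 - 2) (fun s => if s = 0 then 1 else 2) false 8 3 =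
    rhs 2 (2 + 1 - 2) (fun s => if s = 0 then 1 else 2) 8 3 := by
  simp [lhs, rhs, Finset.sum_range_succ, chainW, chainM, chainMu, chainN]; norm_num

/-- inert top (`X = 0`, `Y = 3`), `e = 8`, `a = 9 > e` (exercises the `ψ(q^e)` branch).  PROVED (kernel). -/
example : lhs 2 (2 + 1 - 0) (fun s => if s = 0 then 1 else 0) false 8 9 =
    rhs 2 (2 + 1 - 0) (fun s => if s = 0 then 1 else 0) 8 9 := by
  simp [lhs, rhs, Finset.sum_range_succ, chainW, chainM, chainMu, chainN]; norm_num

/-- ramified top (`ν 1 = 1`, `ν s = 0` for `s ≥ 2`, `Y = 2`), `e = 8`, `a = 5`.  PROVED (kernel). -/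
example : lhs 2 (2 + 1 - 1) (fun s => if s ≤ 1 then 1 else 0) true 8 5 =
    rhs 2 (2 + 1 - 1) (fun s => if s ≤ 1 then 1 else 0) 8 5 := by
  simp [lhs, rhs, Finset.sum_range_succ, chainW, chainM, chainMu, chainN]; norm_num

/-- split top, `e = 7`, `a = 7` (odd exponent at the ceiling's neighbour).  PROVED (kernel). -/
example : lhs 2 (2 + 1 - 2) (fun s => if s = 0 then 1 else 2) false 7 7 =
    rhs 2 (2 + 1 - 2) (fun s => if s = 0 then 1 else 2) 7 7 := by
  simp [lhs, rhs, Finset.sum_range_succ, chainW, chainM, chainMu, chainN]; norm_num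

end Summit.ABC.ABC.Cruxes.DefiniteRTControlPrime.StubIdeas3g7
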